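import Literature.MathematicalPhysics.QuantumFieldTheory.Balaban1983to89.B8DentedCubeMemberBoxRowsL0
import Literature.MathematicalPhysics.QuantumFieldTheory.Balaban1983to89.B8Thm32GBoundDentedCubeMember
import Literature.MathematicalPhysics.QuantumFieldTheory.Balaban1983to89.B8Thm32GBoundCubeMemberHolds

/-!
# `Balaban1983to89.B8Thm32GBoundDentedCubeMemberHolds` — [Balaban1985BackgroundPropagators] THEOREM 3.2 (3.48) AT `U = 1` ON THE DENTED CUBE MEMBER `{Ω′_j}` OF
# [Balaban1985Variational] (148)–(150), ROW-SUMMED: the named fact `B8Thm32GBoundDentedCubeMember.GBoundDentedCubeMemberPrinted d ℓ` (p661669) HOLDS for every `L = ℓ + 1 ≥ 2`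
# — the dented twin of dag-n05-c's `B8Thm32GBoundCubeMemberHolds.gBoundCubeMemberPrinted_of_one_le` (EXACT TRANSFER to p21's level-0 box family)

statement-level skeleton of published theorems with citation tags; proofs where landed; nothing here is a claim about the Yang–Mills mass gap

`[Balaban1985BackgroundPropagators]` ([4], CMP **99** (1985) 389–434) Theorem 3.2 (3.48) p. 398, (3.22)–(3.25) p. 394; `[Balaban1984PropagatorsII]` ("B6", CMP **96** (1984)
223–250) Prop. 2.3 (2.87) p. 238, Lemma 2.1 (2.61) p. 234, (2.14) p. 225, p. 229; `[Balaban1985RegularSpaces]` ("B8" = [6]) (1.91)–(1.92) p. 91, (1.98) p. 92, (1.101) p. 93, p. 98,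
(1.4) p. 77; `[Balaban1985Variational]` ("[15]", CMP **102** (1985) 277–309) (148)–(152) p. 301, p. 300.  PDFs held (`paper:balaban1985-cmp99-…`, `…-cmp102-…`).

CITATION HEADER (lean-in-tree rule).  Cell `pub-ymgap` (YM Track A, HUMAN RULING D-0062), DAG node N05 = [B8], seat `pub-ymgap-dag-n05-e` (g32; FAN-OUT §N05 row s3b,
Proposition-6 lane; piece (d2-e) of the (β) road, file 3 of 3: g31 HANDOFF «Next 1 (ii)», dag-n05-c STANDING GO I.42366, this seat INTENT I.43465).  WHY THIS FILE.  The (β)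
road's crown `…ScalarGammaOfGBound` ∕ `…ScalarGammaOfThm312` takes [4] Thm 3.2 on the dented member as the named hypothesis `hG : GBoundDentedCubeMemberPrinted (d−1) (L−1)`
(p661669).  dag-n05-c's pure transfer (G10 `B8Thm32GBoundCubeMemberHolds`, 2026-08-27) proves the pure twin by EXACT TRANSFER of the consumer's Lagrange multiplier `μ = 𝒢X` to
p21's HYPOTHESIS-FREE `B6Prop23MultiLevelBoxL0.prop23_multiLevelBox` ([B6] Prop. 2.3 on the Neumann box WITH `Λ₀`) and `lemma21_box` ((2.61)) at the box member `cubeDomainsL0`;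
both generic in `D : Domains`.  THIS FILE runs the same transfer at the DENTED box member — r03's `TDomains.toDomains` of g31's `cubeTDomainsDented … (boxP …) …` (level function
`levD`; chart-frame premise from the anchored one by `hΩ_of_anchored`) — with the dented dictionaries of files 1–2 of this unit and g31's `tower_meets_dented ∕ towers_disjoint_dented`;
G10's §1–§2 (`prop23_printed`, the weight windows) are IMPORTED by name.

WHAT THIS FILE PROVES (kernel-checked).  ★★★ `gBoundDentedCubeMemberPrinted_of_one_le (d ℓ) (hℓ : 1 ≤ ℓ) : GBoundDentedCubeMemberPrinted d ℓ` — with G10's constants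
`C_𝒢 = C·K₂₆₁ + (4(d+1)+8)²`, `ρ₀ = 0`, `M₀` = p21's, `N₀` the (2.59)-threshold at rate `δ₁∕2` (functions of `d, ℓ`); the proof is G10's §3 token for token with the dented
suppliers (the level-`0` cells are `□₀ ∖ Ω′₁` — for `k = 1` the dent lies at level `0`, handled by `mem_lamS_zero_iff`; nothing else changes).
HONEST SCOPE ∕ NOT CLAIMED.  The estimate is p21's kernel theorem on the level-`0` box family; this file's content is the transfer on the dented member (print [15] p. 301:
the operators «defined … for the sequence {Ω′_j} instead of {Ω_j}»); count-neutral; N05 ∕ N07 NOT discharged; one finite `T⁴` programme at fixed `ε`, Bałaban as printed;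
nothing continuum ∕ ℝ⁴ ∕ OS ∕ mass-gap ∕ Clay.  No `sorry`, no `def`, no `instance`, no `notation`.  Unit `pub-ymgap-dag-n05-e` (g32), 2026-08-28.

RELATED IN THE TREE, NOT DUPLICATED (`rg -l 'GBoundDentedCubeMemberHolds' Balaban1983to89` = 0, 2026-08-28T22:20Z): G10 `B8Thm32GBoundCubeMemberHolds` (dag-n05-c; the PURE twin,
§1–§2 USED by name), `B8Thm32GBoundDentedCubeMember` (g31; the TARGET), `B8DentedCubeMemberBoxTowers ∕ …BoxRowsL0` (g32), g31's dented geometry, p21∕r03∕r05 L0 files (USED).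
-/
noncomputable section

namespace Literature.MathematicalPhysics.QuantumFieldTheory.Balaban1983to89.B8Thm32GBoundDentedCubeMemberHolds

open scoped Matrix
open B6MultiLevelBoxOperator (N0 mlOp levC gml gml_mul_mlOp aPrinted_one)
open B4Reflection242 (boxDom mem_boxDom blk)
open B6Geom246MultiLevelBoxL0 (bset blkOf blkOf_val corner corner_mem geom lemma21_box)
open B6Ineq268MultiLevelBoxL0 (W W_eq W_pos QB QsB QsB_apply Xk)
open B6Expansion282 (kerOp)
open B6Prop23Chain (mat apply_eq_sum_mat)
open B6Ineq261LevelGap (K261 K261_nonneg theta_lt_one_of_log)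
open B8Ineq192MultiLevelBoxL0 (QB_gml_gml_QsB len_eq)
open B7Prop1Explicit (e)
open B8Eq131Cubes (cube cube_anti)
open B8LambdaSpaceKLevel (wt)
open B8Eq191FlatDirichletForm (isUnit_flatMatrix)
open B8Eq191FlatTowerGram (isUnit_towerGram)
open B8Eq191FlatLettersDentedCubeMember (tower_meets_dented towers_disjoint_dented)
open B8DentedCubeMemberZd (lamST_top)
open B8Eq1101CubeMemberWeights (awPrinted wPrinted awPrinted_facts wPrinted_facts)
open B8Thm32GBoundDentedCubeMember (GBoundDentedCubeMemberPrinted)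
open B8Thm32GBoundCubeMemberHolds (awPrinted_window_all prop23_printed rpow_neg_natCast_eq)
open B8CubeMemberBoxDomains (shift boxP)
open B8CubeMemberBoxDomainsL0 (mem_boxDom_of_mem_cube_zero blockMap_pow_zero)
open B8CubeMemberTorusDomainsDented (cubeTDomainsDented levD levD_le levD_pos_iff hΩ_of_anchored)
open B8DentedCubeMemberBoxTowers (mem_lamS_zero_iff mem_cube_of_tower tower_iff_levD_eq Qt_mulVec_eq wall_rows_bound)
open B8CubeMemberBoxRowsL0 (QB_level_zero corner_blkOf_of_lev_zero)
open B8DentedCubeMemberBoxRowsL0 (blkOf_shift_val QB_translate blockMap_corner_sub_shift exists_site_of_pos_level mulVec_mulVec_transfer)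
open B8Eq348CubeMemberKKT (kkt_of_inverse mem_cube_zero_of_near_cube_one near_wall_dichotomy Q_mulVec_eq eq_of_Q_mulVec_eq_level_zero)
open Node00 (CubeB8D)
open Literature.MathematicalPhysics.QuantumLattice (blockMap)

variable {d : ℕ}

open Classical in
/-- ★★★ **[Balaban1985BackgroundPropagators] THEOREM 3.2 (3.48) AT `U = 1` ON THE DENTED CUBE MEMBER — THE NAMED DENTED 𝒢-BOUND `GBoundDentedCubeMemberPrinted d ℓ` HOLDS
(`L = ℓ + 1 ≥ 2`).**  For the explicit Dirichlet matrices `T = Matrix.of K`, `Q` of the p6 flat consumer at the printed weights on the DENTED cells `c.lamS`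
(`S = Ω′₀ = □₀`), on print's big-block sub-lattice of dented cube data `c : CubeB8D` with `Ω_k` a union of `M_hL^{k+1}`-cubes anchored at `□_k`'s corner:
`wt(j_p)⁴·L^{−(d+1)j_p}·|((QT⁻¹T⁻¹Qᵀ)⁻¹X)_p| ≤ C_𝒢·sup|X|` at every tower `p`, `C_𝒢 = C·K₂₆₁ + (4(d+1)+8)²`.  PROOF = dag-n05-c's exact transfer to p21's [B6] Prop. 2.3 on the
level-`0` box family, run at the dented box member `(cubeTDomainsDented … (boxP …) …).toDomains`: `μ = 𝒢X` is the Lagrange multiplier of `T²u = Qᵀμ, Qu = X`; its translated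
zero extension solves the box system with a block function `ν` read off at the corners; `ν = G(Q′û)` by p21's inverse identity with `|Q′û| ≤ sup|X|`; (2.87) + (2.61); the
wall rows by locality. [cite: Balaban1985BackgroundPropagators, Theorem 3.2 (3.48) p.398, (3.22)–(3.25) p.394; Balaban1984PropagatorsII, Prop. 2.3 (2.87) p.238, Lemma 2.1 (2.61) p.234, (2.14) p.225, p.229; Balaban1985RegularSpaces, (1.91)–(1.92) p.91, (1.4) p.77; Balaban1985Variational, (148)–(151) p.301, p.300] -/
theorem gBoundDentedCubeMemberPrinted_of_one_le (d ℓ : ℕ) (hℓ : 1 ≤ ℓ) : GBoundDentedCubeMemberPrinted d ℓ := by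
  -- constants
  obtain ⟨δ₁, C, M₀, hδ₁, hC, hM₀, hP23⟩ := prop23_printed d ℓ hℓ
  have hL0 : (0 : ℝ) < (ℓ : ℝ) + 1 := by positivity
  set σ : ℝ := δ₁ / 2 with hσ
  have hσ0 : 0 < σ := by positivity
  obtain ⟨N₀, hN₀⟩ : ∃ N₀ : ℕ, N₀ = ⌈4 * ((d : ℝ) + 1) * ((ℓ : ℝ) + 1) / σ⌉₊ + 1 := ⟨_, rfl⟩
  have hN₀pos : 0 < N₀ := by rw [hN₀]; exact Nat.succ_pos _
  have hN₀gt : 4 * ((d : ℝ) + 1) * ((ℓ : ℝ) + 1) < σ * (N₀ : ℝ) := by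
    have h : 4 * ((d : ℝ) + 1) * ((ℓ : ℝ) + 1) / σ < (N₀ : ℝ) := by
      rw [hN₀]; push_cast
      exact lt_of_le_of_lt (Nat.le_ceil _) (by linarith)
    rw [div_lt_iff₀ hσ0] at h
    linarith [mul_comm σ (N₀ : ℝ)]
  set Krow : ℝ := K261 N₀ (d + 1) ((ℓ : ℝ) + 1) 1 (1 * σ)
  have hKrow0 : 0 ≤ Krow := K261_nonneg hL0.le zero_le_one
  refine ⟨C * Krow + (4 * ((d : ℝ) + 1) + 8) ^ 2, 0, M₀, N₀, add_nonneg (mul_nonneg hC.le hKrow0) (sq_nonneg _), ?_⟩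
  intro η hη Mh hMh hM0 K' Ω c R hρd hMd hR hR2 hRN _hρbig hanch S hS B hB K hK T hT Q hQ X s hs hXs p
  -- elementary facts about the data
  have hL : 1 ≤ ℓ + 1 := Nat.succ_pos ℓ
  have hd : 0 < d + 1 := Nat.succ_pos d
  have hMh1 : 1 ≤ Mh := le_trans (by norm_num) hMh
  have hMh2 : 2 ≤ Mh := le_trans (by norm_num) hMh
  have hk : 1 ≤ c.k := c.one_le_k
  have hρL : ℓ + 1 ≤ c.ρ := c.L_le_ρ
  have hρ0 : 0 < c.ρ := lt_of_lt_of_le (Nat.succ_pos ℓ) hρL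
  have hρ4 : 4 ≤ c.ρ := by
    have h4R : 4 ≤ R := by omega
    have hR' : R ≤ R * (Mh * (ℓ + 1)) := Nat.le_mul_of_pos_right _ (Nat.mul_pos (by omega) (Nat.succ_pos ℓ))
    exact h4R.trans (hR'.trans hR)
  have hη0 : η ≠ 0 := hη.ne'
  have h00 : cube (ℓ + 1) c.a c.M c.ρ c.k 0 = c.sq 0 := c.sq_zero.symm
  -- the dented cell family at the top truncation, and its tower lemmas
  have hmeetD := tower_meets_dented c hL le_rfl
  have hdisjD := towers_disjoint_dented c hL le_rfl
  rw [lamST_top] at hmeetD hdisjD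
  -- the printed weights
  obtain ⟨-, hapos, -, -⟩ := awPrinted_facts hℓ
  obtain ⟨hwpos, hrel, hwwin⟩ := wPrinted_facts d hℓ hη
  have hw0 : ∀ j, 0 ≤ wPrinted d ℓ η j := fun j => (hwpos j).le
  have hamax : ∀ j, j ≤ c.k → wPrinted d ℓ η j * η ^ 2 * ((((ℓ + 1 : ℕ) : ℝ)) ^ j) ^ 2 * (((((ℓ + 1 : ℕ) : ℝ)) ^ (d + 1)) ^ j)⁻¹ ≤ 8 := by
    intro j _
    rw [hwwin j]
    exact (awPrinted_window_all hℓ j).2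
  have hw : ∀ j, j ≤ c.k → wPrinted d ℓ η j * (((((ℓ + 1 : ℕ) : ℝ) ^ (d + 1))⁻¹) ^ j) ^ 2 = (η ^ 2)⁻¹ * levC d ℓ (awPrinted ℓ) j :=
    fun j _ => hrel j
  -- the units `T` and `QT⁻²Qᵀ` (n05-e)
  have hTunit : IsUnit T := by rw [hT]; exact isUnit_flatMatrix hd hη0 (ℓ + 1) c.k c.lamS (wPrinted d ℓ η) hw0 K hK S
  have hTT : T * T⁻¹ = 1 := Matrix.mul_nonsing_inv T ((Matrix.isUnit_iff_isUnit_det T).mp hTunit)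
  have hmeet : ∀ p ∈ B, ∃ z ∈ S, blockMap ((ℓ + 1) ^ p.1) z = p.2 := by
    intro p hp
    obtain ⟨hp1, hp2⟩ := (hB p).mp hp
    obtain ⟨z, hz, hzb⟩ := hmeetD p.1 hp1 p.2 hp2
    exact ⟨z, (hS z).mpr hz, hzb⟩
  have hdisjB : ∀ p ∈ B, ∀ p' ∈ B, ∀ z ∈ S, blockMap ((ℓ + 1) ^ p.1) z = p.2 → blockMap ((ℓ + 1) ^ p'.1) z = p'.2 → p = p' := by
    intro p hp p' hp' z hz h1 h2
    obtain ⟨hp1, hp2⟩ := (hB p).mp hp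
    obtain ⟨hp1', hp2'⟩ := (hB p').mp hp'
    obtain ⟨hjj, hyy⟩ := hdisjD p.1 hp1 p'.1 hp1' p.2 hp2 p'.2 hp2' z ((hS z).mp hz) h1 h2
    exact Prod.ext hjj hyy
  have hMunit : IsUnit (Q * T⁻¹ * T⁻¹ * Qᵀ) := by
    rw [hQ, hT]; exact isUnit_towerGram hd hη0 hL c.k c.lamS (wPrinted d ℓ η) hw0 K hK S B hmeet hdisjB
  have hMM : (Q * T⁻¹ * T⁻¹ * Qᵀ) * (Q * T⁻¹ * T⁻¹ * Qᵀ)⁻¹ = 1 :=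
    Matrix.mul_nonsing_inv _ ((Matrix.isUnit_iff_isUnit_det _).mp hMunit)
  -- the Lagrange system: `μ = 𝒢X`, `u = H′X`
  obtain ⟨hTTu, hQu⟩ := kkt_of_inverse T Q hTT hMM X
  set μ : ↥B → ℝ := (Q * T⁻¹ * T⁻¹ * Qᵀ)⁻¹ *ᵥ X
  set u : ↥S → ℝ := (T⁻¹ * T⁻¹ * Qᵀ) *ᵥ μ
  have hμp : (∑ p' : ↥B, (Q * T⁻¹ * T⁻¹ * Qᵀ)⁻¹ p p' * X p') = μ p := rfl
  rw [hμp]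
  -- the box: host `X`, the L0 member, p21's operator `Δ′_a`
  set t := shift ℓ Mh c.a c.ρ c.k c.k
  -- the dented BOX member: r03's `toDomains` of g31's dented torus member at the exact host `boxP`, its premise from the anchored one
  have hΩc := hΩ_of_anchored (Mh := Mh) hMh1 c (fun x x' hxx => hanch x x' (by simpa only [B6MultiLevelBoxOperator.bigSide] using hxx))
  set DL := (cubeTDomainsDented hℓ hMh2 c hρd hMd hR (boxP ℓ c.M c.ρ c.k c.k) (fun _ => le_rfl) hΩc).toDomains
  have hlevDL : DL.lev = levD Mh c := rfl
  have hPbox : ∀ μ' : Fin (d + 1), 1 ≤ boxP (d := d) ℓ c.M c.ρ c.k c.k μ' := fun μ' => le_trans hρ0 (Nat.le_add_right _ _)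
  have hNpos : ∀ i, 1 ≤ N0 ℓ Mh c.k (boxP ℓ c.M c.ρ c.k c.k) i := fun i => by
    show 0 < (ℓ + 1) ^ c.k * ((ℓ + 1) * (Mh * boxP ℓ c.M c.ρ c.k c.k i))
    exact Nat.mul_pos (Nat.pow_pos (Nat.succ_pos ℓ)) (Nat.mul_pos (Nat.succ_pos ℓ) (Nat.mul_pos (by omega) (hPbox i)))
  have hAgml : gml (N0 ℓ Mh c.k (boxP ℓ c.M c.ρ c.k c.k)) ℓ c.k (levD Mh c) (awPrinted ℓ) *
      mlOp (N0 ℓ Mh c.k (boxP ℓ c.M c.ρ c.k c.k)) ℓ c.k (levD Mh c) (awPrinted ℓ) = 1 :=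
    gml_mul_mlOp hNpos (levD_le Mh c) hapos
  have hGA : ∀ v : ↥(boxDom (N0 ℓ Mh c.k (boxP ℓ c.M c.ρ c.k c.k))) → ℝ,
      gml (N0 ℓ Mh c.k (boxP ℓ c.M c.ρ c.k c.k)) ℓ c.k (levD Mh c) (awPrinted ℓ) *ᵥ
        (mlOp (N0 ℓ Mh c.k (boxP ℓ c.M c.ρ c.k c.k)) ℓ c.k (levD Mh c) (awPrinted ℓ) *ᵥ v) = v := fun v => by
    rw [Matrix.mulVec_mulVec, hAgml, Matrix.one_mulVec]
  -- the translated zero extension `û` of `u`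
  set g : (Fin (d + 1) → ℤ) → ℝ := fun z => if h : z ∈ S then u ⟨z, h⟩ else 0 with hg
  set uh : ↥(boxDom (N0 ℓ Mh c.k (boxP ℓ c.M c.ρ c.k c.k))) → ℝ := fun y => g (y.1 - t) with huh
  -- `(T(Tu))(x) = η⁻⁴(Δ′_a²û)(x + t)` at every `x` whose `2`-ball lies in `□₀`
  have hstar2 : ∀ x : ↥S, (∀ τ : Fin (d + 1) → ℤ, (∀ i, |τ i| ≤ 2) → x.1 + τ ∈ cube (ℓ + 1) c.a c.M c.ρ c.k 0) →
      ∀ y : ↥(boxDom (N0 ℓ Mh c.k (boxP ℓ c.M c.ρ c.k c.k))), y.1 = x.1 + t →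
      (T *ᵥ (T *ᵥ u)) x = ((η ^ 2)⁻¹) ^ 2 *
        (mlOp (N0 ℓ Mh c.k (boxP ℓ c.M c.ρ c.k c.k)) ℓ c.k (levD Mh c) (awPrinted ℓ) *ᵥ
          (mlOp (N0 ℓ Mh c.k (boxP ℓ c.M c.ρ c.k c.k)) ℓ c.k (levD Mh c) (awPrinted ℓ) *ᵥ uh)) y :=
    fun x hx2 y hyx => mulVec_mulVec_transfer hℓ hMh2 c DL hlevDL (wPrinted d ℓ η) (awPrinted ℓ) hw K hK S hS T hT
      u uh (fun _ => rfl) x hx2 y hyx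
  -- sites of `□₁` have their `2`-ball in `□₀`
  have hHB1 : ∀ x, x ∈ cube (ℓ + 1) c.a c.M c.ρ c.k 1 → ∀ τ : Fin (d + 1) → ℤ, (∀ i, |τ i| ≤ 2) → x + τ ∈ cube (ℓ + 1) c.a c.M c.ρ c.k 0 :=
    fun x hx τ hτ => mem_cube_zero_of_near_cube_one c.a c.M hk hx (r := 2) (by omega) (fun i => by exact_mod_cast hτ i)
  -- the value of `Δ′_a²û` at a translated site of `□₁` in the tower `p′`: `η⁴·L^{−(d+1)j}·μ_{p′}`
  have hdeep : ∀ (x : ↥S) (p' : ↥B), x.1 ∈ cube (ℓ + 1) c.a c.M c.ρ c.k 1 → blockMap ((ℓ + 1) ^ p'.1.1) x.1 = p'.1.2 →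
      ∀ y : ↥(boxDom (N0 ℓ Mh c.k (boxP ℓ c.M c.ρ c.k c.k))), y.1 = x.1 + t →
      (mlOp (N0 ℓ Mh c.k (boxP ℓ c.M c.ρ c.k c.k)) ℓ c.k (levD Mh c) (awPrinted ℓ) *ᵥ
          (mlOp (N0 ℓ Mh c.k (boxP ℓ c.M c.ρ c.k c.k)) ℓ c.k (levD Mh c) (awPrinted ℓ) *ᵥ uh)) y
        = (η ^ 2) ^ 2 * ((((((ℓ + 1 : ℕ) : ℝ)) ^ (d + 1))⁻¹) ^ p'.1.1 * μ p') := by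
    intro x p' hx1 hxp y hyx
    have h1 := hstar2 x (hHB1 x.1 hx1) y hyx
    rw [hTTu, Qt_mulVec_eq c S hS B hB Q hQ μ x p' hxp] at h1
    have hη2 : (η ^ 2) ^ 2 * ((η ^ 2)⁻¹) ^ 2 = 1 := by field_simp
    calc _ = (η ^ 2) ^ 2 * (((η ^ 2)⁻¹) ^ 2 * (mlOp (N0 ℓ Mh c.k (boxP ℓ c.M c.ρ c.k c.k)) ℓ c.k (levD Mh c) (awPrinted ℓ) *ᵥ
          (mlOp (N0 ℓ Mh c.k (boxP ℓ c.M c.ρ c.k c.k)) ℓ c.k (levD Mh c) (awPrinted ℓ) *ᵥ uh)) y) := by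
            rw [← mul_assoc, hη2, one_mul]
      _ = _ := by rw [← h1]
  -- the block function `ν(s) := (Δ′_a²û)(corner s)` and `Δ′_a²û = Q′*ν`
  set ν : ↥(bset DL) → ℝ := fun sB =>
    (mlOp (N0 ℓ Mh c.k (boxP ℓ c.M c.ρ c.k c.k)) ℓ c.k (levD Mh c) (awPrinted ℓ) *ᵥ
      (mlOp (N0 ℓ Mh c.k (boxP ℓ c.M c.ρ c.k c.k)) ℓ c.k (levD Mh c) (awPrinted ℓ) *ᵥ uh)) ⟨corner DL sB, corner_mem DL sB⟩ with hν
  have h3a : ∀ y : ↥(boxDom (N0 ℓ Mh c.k (boxP ℓ c.M c.ρ c.k c.k))),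
      (mlOp (N0 ℓ Mh c.k (boxP ℓ c.M c.ρ c.k c.k)) ℓ c.k (levD Mh c) (awPrinted ℓ) *ᵥ
        (mlOp (N0 ℓ Mh c.k (boxP ℓ c.M c.ρ c.k c.k)) ℓ c.k (levD Mh c) (awPrinted ℓ) *ᵥ uh)) y = ν (blkOf DL y) := by
    intro y
    rcases Nat.eq_zero_or_pos (levD Mh c y.1) with h0 | hpos'
    · -- level `0`: the block of `y` is `{y}` and its corner is `y`
      have hc : corner DL (blkOf DL y) = y.1 := corner_blkOf_of_lev_zero DL y h0
      have hy : (⟨corner DL (blkOf DL y), corner_mem DL (blkOf DL y)⟩ : ↥(boxDom (N0 ℓ Mh c.k (boxP ℓ c.M c.ρ c.k c.k)))) = y := Subtype.ext hc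
      simp only [hν, hy]
    · -- level `j ≥ 1`: `y = x + t` with `x ∈ □₁` in the tower `p′ = (j, Bʲ(x))`; the corner is another site of that tower
      set x : Fin (d + 1) → ℤ := y.1 - t
      have hyx : y.1 = x + t := (sub_add_cancel _ _).symm
      have hx1' : x ∈ c.sq 1 := (levD_pos_iff Mh c y.1).mp hpos'
      have hx1 : x ∈ cube (ℓ + 1) c.a c.M c.ρ c.k 1 := c.sq_subset_cube hk hx1'
      have hx0 : x ∈ cube (ℓ + 1) c.a c.M c.ρ c.k 0 := cube_anti (Nat.zero_le 1) hk hx1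
      have hxS : x ∈ S := (hS x).mpr (by rw [← h00]; exact hx0)
      set j := levD Mh c y.1
      have hjn : j ≤ c.k := levD_le Mh c _
      have hxj : blockMap ((ℓ + 1) ^ j) x ∈ c.lamS j :=
        (tower_iff_levD_eq c hjn hx0 (Mh := Mh)).mpr (by rw [← hyx])
      have hpB : (j, blockMap ((ℓ + 1) ^ j) x) ∈ B := (hB _).mpr ⟨hjn, hxj⟩
      have hvy := hdeep ⟨x, hxS⟩ ⟨_, hpB⟩ hx1 rfl y hyx
      have hcorner := blockMap_corner_sub_shift c DL hlevDL y hyx hx0 hjn hxj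
      set xc : Fin (d + 1) → ℤ := corner DL (blkOf DL y) - t with hxc
      have hxcj : blockMap ((ℓ + 1) ^ j) xc ∈ c.lamS j := by rw [hcorner]; exact hxj
      have hj1 : 1 ≤ j := hpos'
      have hxc1 : xc ∈ cube (ℓ + 1) c.a c.M c.ρ c.k 1 := cube_anti hj1 hjn (mem_cube_of_tower c hxcj)
      have hxcS : xc ∈ S := (hS xc).mpr (by rw [← h00]; exact cube_anti (Nat.zero_le 1) hk hxc1)
      have hvc := hdeep ⟨xc, hxcS⟩ ⟨_, hpB⟩ hxc1 hcorner ⟨corner DL (blkOf DL y), corner_mem DL (blkOf DL y)⟩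
        (by exact (sub_add_cancel _ _).symm)
      rw [hvy]
      simp only [hν]
      rw [hvc]
  have h3b : mlOp (N0 ℓ Mh c.k (boxP ℓ c.M c.ρ c.k c.k)) ℓ c.k (levD Mh c) (awPrinted ℓ) *ᵥ
      (mlOp (N0 ℓ Mh c.k (boxP ℓ c.M c.ρ c.k c.k)) ℓ c.k (levD Mh c) (awPrinted ℓ) *ᵥ uh) = QsB DL ν := by
    funext y; rw [h3a y, QsB_apply]
  -- hence `Q′û = (Q′G′²Q′*)ν`
  have h3d : kerOp (W DL) (Xk DL (awPrinted ℓ)) ν = QB DL uh := by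
    rw [← QB_gml_gml_QsB (D := DL) (a := awPrinted ℓ) ν]
    simp only [hlevDL]
    rw [← h3b, hGA, hGA]
  -- p21's inverse: `ν = G(Q′û)`
  obtain ⟨G, hG1, -, hGb⟩ := hP23 c.k Mh R hM0 hR2 (boxP ℓ c.M c.ρ c.k c.k) hPbox DL
  have h3e : ν = G (QB DL uh) := by
    have h := congrArg (fun Φ : Module.End ℝ (↥(bset DL) → ℝ) => Φ ν) hG1
    simp only [Module.End.mul_apply, Module.End.one_apply] at h
    rw [h3d] at h
    exact h.symm
  -- `|Q′û| ≤ s` blockwise: the constraint `Qu = X` at every level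
  have h3c : ∀ s' : ↥(bset DL), |QB DL uh s'| ≤ s := by
    intro s'
    rcases Nat.eq_zero_or_pos s'.1.1 with h0 | hpos'
    · -- level `0`: the point evaluation at the corner, a level-`0` site (or outside `□₀`)
      rw [QB_level_zero DL uh s' h0]
      simp only [huh, hg]
      split_ifs with hmem
      · -- the corner is a translated site of the collar `□₀ ∖ □₁`
        have hz0 : corner DL s' - t ∈ cube (ℓ + 1) c.a c.M c.ρ c.k 0 := by rw [h00]; exact (hS _).mp hmem
        have hlev0 : levD Mh c (corner DL s') = 0 := (B6Geom246MultiLevelBoxL0.lev_corner DL s').trans h0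
        have hz1 : corner DL s' - t ∉ c.sq 1 := fun h1 => by
          have := (levD_pos_iff Mh c (corner DL s')).mpr h1
          omega
        have hzB : ((0 : ℕ), corner DL s' - t) ∈ B := by
          refine (hB _).mpr ⟨Nat.zero_le _, ?_⟩
          change corner DL s' - t ∈ c.lamS 0
          rw [mem_lamS_zero_iff]
          exact ⟨hz0, hz1⟩
        rw [eq_of_Q_mulVec_eq_level_zero S B Q hQ u X hQu hmem hzB]
        exact hXs _
      · rw [abs_zero]; exact hs
    · -- level `j ≥ 1`: the block average is `(Qu)_p = X_p`
      obtain ⟨y, x, hyx, hx1, hx0, hjn, hxj, hys⟩ := exists_site_of_pos_level c DL hlevDL s' hpos'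
      have hpB : (s'.1.1, blockMap ((ℓ + 1) ^ s'.1.1) x) ∈ B := (hB _).mpr ⟨hjn, hxj⟩
      have hQB := QB_translate hℓ hMh2 c DL hlevDL S hS y hyx hx0 hjn hxj g
      rw [hys] at hQB
      have hQrow := Q_mulVec_eq S B Q hQ u ⟨_, hpB⟩
      rw [hQu] at hQrow
      -- the two block sums agree
      have hsum : (∑ z ∈ S.filter (fun z => blockMap ((ℓ + 1) ^ s'.1.1) z = blockMap ((ℓ + 1) ^ s'.1.1) x), g z)
          = ∑ z ∈ Finset.univ.filter (fun z : ↥S => blockMap ((ℓ + 1) ^ s'.1.1) z.1 = blockMap ((ℓ + 1) ^ s'.1.1) x), u z := by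
        rw [Finset.sum_filter, Finset.sum_filter, ← Finset.sum_coe_sort S]
        refine Finset.sum_congr rfl fun z _ => ?_
        simp only [hg, dif_pos z.2, Subtype.coe_eta]
      have hcast : (((((ℓ : ℝ) + 1) ^ s'.1.1) ^ (d + 1)))⁻¹ = (((((ℓ + 1 : ℕ) : ℝ)) ^ (d + 1))⁻¹) ^ s'.1.1 := by
        push_cast; rw [inv_pow, ← pow_mul, ← pow_mul, mul_comm]
      have hval : QB DL uh s' = X ⟨_, hpB⟩ := by
        rw [show uh = (fun y' => g (y'.1 - shift ℓ Mh c.a c.ρ c.k c.k)) from rfl, hQB, hsum, hcast]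
        exact hQrow.symm
      rw [hval]; exact hXs _
  -- Lemma 2.1 (2.61) on the box at rate `σ = δ₁∕2`
  have hθ : Real.exp (-(1 * σ)) * ((ℓ : ℝ) + 1) ^ ((2 * (d + 1 : ℕ) : ℝ) / N₀) < 1 := by
    refine theta_lt_one_of_log hL0 hN₀pos ?_
    have hlog : Real.log ((ℓ : ℝ) + 1) ≤ (ℓ : ℝ) + 1 := (Real.log_le_sub_one_of_pos hL0).trans (by linarith)
    push_cast
    nlinarith [mul_le_mul_of_nonneg_left hlog (by positivity : (0 : ℝ) ≤ 2 * ((d : ℝ) + 1))]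
  obtain ⟨-, h261, -, -⟩ := lemma21_box DL hMh1 hPbox hN₀pos hRN hσ0.le (α := 1) zero_le_one le_rfl hθ
  -- (2.87) + (2.61): `|ν(s)| ≤ C·L^{−4j(s)}·K·s`
  have h3f : ∀ s₁ : ↥(bset DL), |ν s₁| ≤ C * ((((ℓ : ℝ) + 1) ^ s₁.1.1) ^ 4)⁻¹ * Krow * s := by
    intro s₁
    have hlen₁ : (geom DL).len s₁ = ((ℓ : ℝ) + 1) ^ s₁.1.1 := len_eq DL s₁
    have hlenpos : 0 < ((ℓ : ℝ) + 1) ^ s₁.1.1 := by positivity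
    -- termwise bound on the row of `G`
    have hterm : ∀ s' : ↥(bset DL), |mat G s₁ s' * QB DL uh s'| ≤
        C * ((((ℓ : ℝ) + 1) ^ s₁.1.1) ^ 4)⁻¹ * s * Real.exp (-(1 * σ * (geom DL).dist s₁ s')) := by
      intro s'
      have hW := W_pos DL s'
      have hb := hGb s₁ s'
      rw [abs_div, abs_of_pos hW, div_le_iff₀ hW] at hb
      have hlen' : (geom DL).len s' = ((ℓ : ℝ) + 1) ^ s'.1.1 := len_eq DL s'
      have hlenpos' : 0 < ((ℓ : ℝ) + 1) ^ s'.1.1 := by positivity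
      rw [hlen₁, hlen', show (-(4 : ℝ)) = -((4 : ℕ) : ℝ) by norm_num, rpow_neg_natCast_eq hlenpos 4, rpow_neg_natCast_eq hlenpos' (d + 1),
        W_eq] at hb
      have hWlen : ((((ℓ : ℝ) + 1) ^ s'.1.1) ^ (d + 1))⁻¹ * ((((ℓ : ℝ) + 1) ^ s'.1.1) ^ (d + 1)) = 1 :=
        inv_mul_cancel₀ (by positivity)
      rw [abs_mul]
      calc |mat G s₁ s'| * |QB DL uh s'|
          ≤ (C * ((((ℓ : ℝ) + 1) ^ s₁.1.1) ^ 4)⁻¹ * ((((ℓ : ℝ) + 1) ^ s'.1.1) ^ (d + 1))⁻¹ * Real.exp (-(δ₁ / 2 * (geom DL).dist s₁ s')) *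
              ((((ℓ : ℝ) + 1) ^ s'.1.1) ^ (d + 1))) * s := mul_le_mul hb (h3c s') (abs_nonneg _) (by positivity)
        _ = C * ((((ℓ : ℝ) + 1) ^ s₁.1.1) ^ 4)⁻¹ * s * Real.exp (-(1 * σ * (geom DL).dist s₁ s')) := by
              rw [hσ, one_mul]
              calc _ = C * ((((ℓ : ℝ) + 1) ^ s₁.1.1) ^ 4)⁻¹ * Real.exp (-(δ₁ / 2 * (geom DL).dist s₁ s')) *
                    (((((ℓ : ℝ) + 1) ^ s'.1.1) ^ (d + 1))⁻¹ * ((((ℓ : ℝ) + 1) ^ s'.1.1) ^ (d + 1))) * s := by ring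
                _ = _ := by rw [hWlen]; ring
    rw [h3e, apply_eq_sum_mat G (QB DL uh) s₁]
    calc |∑ s', mat G s₁ s' * QB DL uh s'|
        ≤ ∑ s', |mat G s₁ s' * QB DL uh s'| := Finset.abs_sum_le_sum_abs _ _
      _ ≤ ∑ s', C * ((((ℓ : ℝ) + 1) ^ s₁.1.1) ^ 4)⁻¹ * s * Real.exp (-(1 * σ * (geom DL).dist s₁ s')) := Finset.sum_le_sum fun s' _ => hterm s'
      _ = C * ((((ℓ : ℝ) + 1) ^ s₁.1.1) ^ 4)⁻¹ * s * ∑ s', Real.exp (-(1 * σ * (geom DL).dist s₁ s')) := by rw [Finset.mul_sum]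
      _ ≤ C * ((((ℓ : ℝ) + 1) ^ s₁.1.1) ^ 4)⁻¹ * s * Krow := mul_le_mul_of_nonneg_left (h261 s₁) (by positivity)
      _ = C * ((((ℓ : ℝ) + 1) ^ s₁.1.1) ^ 4)⁻¹ * Krow * s := by ring
  -- conclusion at the tower `p`
  have hCKle : C * Krow * s ≤ (C * Krow + (4 * ((d : ℝ) + 1) + 8) ^ 2) * s := by nlinarith
  have hWle : (4 * ((d : ℝ) + 1) + 8) ^ 2 * s ≤ (C * Krow + (4 * ((d : ℝ) + 1) + 8) ^ 2) * s := by nlinarith [mul_nonneg hC.le hKrow0]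
  have hcastL : (((ℓ + 1 : ℕ) : ℝ)) = (ℓ : ℝ) + 1 := by push_cast; ring
  obtain ⟨hp1, hp2⟩ := (hB p.1).mp p.2
  rcases Nat.eq_zero_or_pos p.1.1 with hj0 | hjpos
  · -- a level-`0` tower `p = (0, x₀)`, `x₀ ∈ □₀ ∖ □₁`
    have hx₀ : p.1.2 ∈ c.lamS 0 := by rw [← hj0]; exact hp2
    rw [mem_lamS_zero_iff] at hx₀
    have hx₀S : p.1.2 ∈ S := (hS _).mpr (by rw [← h00]; exact hx₀.1)
    have hcol : blockMap ((ℓ + 1) ^ p.1.1) p.1.2 = p.1.2 := by rw [hj0, blockMap_pow_zero]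
    have hμx : (T *ᵥ (T *ᵥ u)) ⟨p.1.2, hx₀S⟩ = μ p := by
      rw [hTTu, Qt_mulVec_eq c S hS B hB Q hQ μ ⟨p.1.2, hx₀S⟩ p hcol, hj0, pow_zero, one_mul]
    have hwt : wt (ℓ + 1) η p.1.1 ^ 4 * (((((ℓ + 1 : ℕ) : ℝ)) ^ (d + 1)) ^ p.1.1)⁻¹ = (η ^ 2) ^ 2 := by
      rw [hj0]; unfold wt; rw [pow_zero, pow_zero, one_mul, inv_one, mul_one]; ring
    rw [hwt, ← hμx]
    rcases near_wall_dichotomy c.a c.M hk hρ4 p.1.2 with hnear | hfar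
    · -- the `2`-ball of `x₀` lies in `□₀`: transfer to the box, a level-`0` block
      set y₀ : ↥(boxDom (N0 ℓ Mh c.k (boxP ℓ c.M c.ρ c.k c.k))) := ⟨p.1.2 + t, mem_boxDom_of_mem_cube_zero hℓ hMh2 c.a c.one_le_k le_rfl hx₀.1⟩
      have h1 := hstar2 ⟨p.1.2, hx₀S⟩ hnear y₀ rfl
      have hlev : (blkOf DL y₀).1.1 = 0 := by
        have hv := blkOf_shift_val c DL hlevDL y₀ rfl hx₀.1 (Nat.zero_le _) (by rw [blockMap_pow_zero, ← hj0]; exact hp2)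
        rw [hv]
      have hb := h3f (blkOf DL y₀)
      rw [← h3a y₀, hlev, pow_zero, one_pow, inv_one, mul_one] at hb
      rw [h1, abs_mul, abs_of_nonneg (by positivity : (0 : ℝ) ≤ ((η ^ 2)⁻¹) ^ 2), ← mul_assoc,
        show (η ^ 2) ^ 2 * ((η ^ 2)⁻¹) ^ 2 = 1 by field_simp, one_mul]
      exact hb.trans hCKle
    · -- the `2`-ball of `x₀` misses `□₁`: the wall rows by locality
      have hu0 : ∀ z : ↥S, (∀ i, |z.1 i - p.1.2 i| ≤ 2) → ∀ hp : ((0 : ℕ), z.1) ∈ B, u z = X ⟨(0, z.1), hp⟩ :=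
        fun z _ hp => eq_of_Q_mulVec_eq_level_zero S B Q hQ u X hQu z.2 hp
      have hwall := wall_rows_bound c hη0 (wPrinted d ℓ η) hw0 (amax := 8) (by norm_num) hamax S hS B hB K hK T hT
        u X s hs hXs ⟨p.1.2, hx₀S⟩ hfar hu0
      have hη4 : (0 : ℝ) < (η ^ 2) ^ 2 := by positivity
      have hηη : (η ^ 2) ^ 2 * ((η ^ 2)⁻¹) ^ 2 = 1 := by field_simp
      calc (η ^ 2) ^ 2 * |(T *ᵥ (T *ᵥ u)) ⟨p.1.2, hx₀S⟩|
          ≤ (η ^ 2) ^ 2 * (((4 * ((d : ℝ) + 1) + 8) * (η ^ 2)⁻¹) ^ 2 * s) := mul_le_mul_of_nonneg_left hwall hη4.le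
        _ = ((η ^ 2) ^ 2 * ((η ^ 2)⁻¹) ^ 2) * ((4 * ((d : ℝ) + 1) + 8) ^ 2 * s) := by ring
        _ = (4 * ((d : ℝ) + 1) + 8) ^ 2 * s := by rw [hηη, one_mul]
        _ ≤ _ := hWle
  · -- a tower of level `j ≥ 1`: transfer to the box at a site of the tower block
    obtain ⟨z₀, hz₀0, hz₀p⟩ := hmeetD p.1.1 hp1 p.1.2 hp2
    have hz₀S : z₀ ∈ S := (hS z₀).mpr hz₀0
    have hz₀c : z₀ ∈ cube (ℓ + 1) c.a c.M c.ρ c.k 0 := by rw [h00]; exact hz₀0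
    have hz₀j : blockMap ((ℓ + 1) ^ p.1.1) z₀ ∈ c.lamS p.1.1 := by rw [hz₀p]; exact hp2
    have hz₀1 : z₀ ∈ cube (ℓ + 1) c.a c.M c.ρ c.k 1 := cube_anti hjpos hp1 (mem_cube_of_tower c hz₀j)
    set y₀ : ↥(boxDom (N0 ℓ Mh c.k (boxP ℓ c.M c.ρ c.k c.k))) := ⟨z₀ + t, mem_boxDom_of_mem_cube_zero hℓ hMh2 c.a c.one_le_k le_rfl hz₀c⟩
    have hv := hdeep ⟨z₀, hz₀S⟩ p hz₀1 hz₀p y₀ rfl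
    have hlev : (blkOf DL y₀).1.1 = p.1.1 := by
      have hval := blkOf_shift_val c DL hlevDL y₀ rfl hz₀c hp1 hz₀j
      rw [hval]
    have hb := h3f (blkOf DL y₀)
    rw [← h3a y₀, hv, hlev] at hb
    -- `hb : |η⁴·(L^{−(d+1)j}·μ_p)| ≤ C·(L^{4j})⁻¹·K·s`; the goal carries `wt(j)⁴ = L^{4j}η⁴`
    have hLj : (0 : ℝ) < (((ℓ : ℝ) + 1) ^ p.1.1) ^ 4 := by positivity
    have hcpos : (0 : ℝ) ≤ (((((ℓ + 1 : ℕ) : ℝ)) ^ (d + 1))⁻¹) ^ p.1.1 := by positivity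
    rw [abs_mul, abs_mul, abs_of_nonneg (by positivity : (0 : ℝ) ≤ (η ^ 2) ^ 2), abs_of_nonneg hcpos] at hb
    have hwt : wt (ℓ + 1) η p.1.1 ^ 4 * (((((ℓ + 1 : ℕ) : ℝ)) ^ (d + 1)) ^ p.1.1)⁻¹
        = (((ℓ : ℝ) + 1) ^ p.1.1) ^ 4 * ((η ^ 2) ^ 2 * (((((ℓ + 1 : ℕ) : ℝ)) ^ (d + 1))⁻¹) ^ p.1.1) := by
      unfold wt; rw [hcastL, inv_pow]; ring
    rw [hwt, mul_assoc, mul_assoc]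
    have hLL : (((ℓ : ℝ) + 1) ^ p.1.1) ^ 4 * ((((ℓ : ℝ) + 1) ^ p.1.1) ^ 4)⁻¹ = 1 := mul_inv_cancel₀ hLj.ne'
    calc (((ℓ : ℝ) + 1) ^ p.1.1) ^ 4 * ((η ^ 2) ^ 2 * ((((((ℓ + 1 : ℕ) : ℝ)) ^ (d + 1))⁻¹) ^ p.1.1 * |μ p|))
        ≤ (((ℓ : ℝ) + 1) ^ p.1.1) ^ 4 * (C * ((((ℓ : ℝ) + 1) ^ p.1.1) ^ 4)⁻¹ * Krow * s) := mul_le_mul_of_nonneg_left hb hLj.le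
      _ = ((((ℓ : ℝ) + 1) ^ p.1.1) ^ 4 * ((((ℓ : ℝ) + 1) ^ p.1.1) ^ 4)⁻¹) * (C * Krow * s) := by ring
      _ = C * Krow * s := by rw [hLL, one_mul]
      _ ≤ _ := hCKle


#print axioms gBoundDentedCubeMemberPrinted_of_one_le
end Literature.MathematicalPhysics.QuantumFieldTheory.Balaban1983to89.B8Thm32GBoundDentedCubeMemberHolds

end
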